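import Literature.MathematicalPhysics.QuantumFieldTheory.PlaquetteWeightPolymers
import HarnessLib

/-!
# Polymer activities of a plaquette weight on a compact group `G` with a twist by a central involution `z`

Topic `Literature/MathematicalPhysics/QuantumFieldTheory`; vocabulary of `ConstructiveQFTWave0.lean` (`GaugeConfig d L G`,
`Plaquette`, `Edge`, `plaquetteHolonomy`, `haarProbability G`), `VortexTwistCohomology.lean` (namespace `Tomboulis2007`:
`linkInd`, `flipCount`, `coboundary` — the mod-2 cochain combinatorics of the torus, group-independent),
`CharacterActionPolymers.lean` (`linkRel`, `torusPolymers`, `sheetAt`) and `PlaquetteWeightPolymers.lean` (the case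
`G = SU(2)`, `z = -𝟙`: `centreEven`, `centreOdd`, `weightActivity`, `weightPolymerActivity`, `weightZ`). DEFINITIONS with
elementary API; no fact, nothing asserted about convergence.

K. R. Ito, E. Seiler, arXiv:0803.3019 [ItoSeiler2008Further] §2 Theorem 2.2 (1): "Let `G = U(1)` or `G = SU(2)`. Then there
is a `β₁ > 0` such that for `β < β₁` [the vortex free energy `F = 1 - Z⁻_Λ/Z_Λ` obeys the area decay law]", with Remark 2.1
(3): "The center of `G = U(1)` is again `U(1)`. Then we consider `U(p) = exp(iθ_p)` and `U_ω(p) = exp(i(θ_p + ω))` for `p ∈ 𝒱`.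
`U_ω(p) = -U(p)` for `ω = π`."  The strong-coupling polymer expansion behind it (E. T. Tomboulis, arXiv:0707.2179
[Tomboulis2007Confinement] §6.2 (6.5)–(6.10) and §4 (4.4)–(4.5); G. Münster, Nucl. Phys. B180 (1981) 23; K. Osterwalder,
E. Seiler, Ann. Phys. 110 (1978) 440 §3) uses of the gauge group only: a normalised Haar measure on a compact group, and a
CENTRAL element `z` with `z² = 1` by which the twist multiplies the holonomies of the twisted plaquettes (`-𝟙 ∈ SU(2)`,
`-1 = e^{iπ} ∈ U(1)`).  This file sets the expansion up at that generality — an arbitrary group `G` (compact, second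
countable where measures enter), an arbitrary `z : G` (centrality and `z * z = 1` appear as hypotheses of the lemmas that
need them) and an arbitrary plaquette weight `w : G → ℝ`:

* `linkMul z E`, `mulLinks z E U` — the change of variables `U_b ↦ z U_b` on the links `b ∈ E`
  (`Tomboulis2007.flipLinks` for `SU(2)`); `plaquetteHolonomy_mulLinks`: the holonomy of `p` picks up `z^{k_p(E)}`,
  `k_p(E) = Tomboulis2007.flipCount E p`; `measurePreserving_mulLinks` (left invariance of Haar measure);
* `evenPart z w`, `oddPart z w` — `w_±(U) = (w(U) ± w(zU))/2` (`centreEven`, `centreOdd` for `SU(2)`);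
* `twistActivity z w V U p` — the activity `w^{(V)}(U_p) - 1` (`w(z U_p) - 1` on `p ∈ V`, `w(U_p) - 1` off `V`);
* `twistPolymerActivity z w V X` — `z^{(V)}(X) = ∫ ∏_{p∈X} (w^{(V)}(U_p) - 1) ∏_b dU_b` (complex; `0` off polymers),
  T07 (6.6);
* `twistZ d L z w V` — the twisted partition function `∫ ∏_p w^{(V)}(U_p) ∏_b dU_b` of the weight `w`, T07 (4.5);
* `twistActivity_negOne`, `twistPolymerActivity_negOne`, `twistZ_negOne`: for `G = SU(2)`, `z = -𝟙` these are the objects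
  of `PlaquetteWeightPolymers.lean`.

HONEST FRAMING: finite-volume definitions and algebraic identities only; the convergent expansion, the twist locality and
the vortex bound (hence IS08 Thm 2.2 (1) for `U(1)` AND `SU(2)` on symmetric tori) are the theorem files
`CentralTwistPolymerExpansion.lean`, `CentralTwistLocality.lean`, `CentralTwistVortexBound.lean`.
-/

noncomputable section

open MeasureTheory Finset
open scoped BigOperators
open Literature.MathematicalPhysics.QuantumLattice
open Literature.Probability.LatticeModels (IsRConnected)

namespace Literature.MathematicalPhysics.QuantumFieldTheory

namespace CentralTwist

open Tomboulis2007

variable {d L : ℕ} {G : Type*} [Group G]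

/-! ### The change of variables `U_b ↦ z U_b` on a set of links -/

/-- The multiplier carried by a link under the change of variables along `E`: `z` on the links of `E`, `1` elsewhere
(`Tomboulis2007.linkSign` for `SU(2)`, `z = -𝟙`). [cite: Tomboulis2007Confinement, §4 (text after (4.1))] -/
def linkMul (z : G) (E : Finset (Edge d L)) (e : Edge d L) : G := if e ∈ E then z else 1

/-- **The change of variables `U_b ↦ z U_b` for the bonds `b ∈ E`** (all other link variables unchanged); for
`G = SU(2)`, `z = -𝟙` this is `Tomboulis2007.flipLinks`, for `G = U(1)`, `z = -1` it is `θ_b ↦ θ_b + π`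
(Ito–Seiler 2008 Remark 2.1 (3)). [cite: Tomboulis2007Confinement, §4 (text after (4.1))]
[cite: ItoSeiler2008Further, §2 Remark 2.1 (3)] -/
def mulLinks (z : G) (E : Finset (Edge d L)) (U : GaugeConfig d L G) : GaugeConfig d L G :=
  fun e => linkMul z E e * U e

/-- `linkMul z E e = z^{𝟙_E(e)}`. [cite: Tomboulis2007Confinement, §4 (text after (4.1))] -/
theorem linkMul_eq_pow (z : G) (E : Finset (Edge d L)) (e : Edge d L) : linkMul z E e = z ^ linkInd E e := by
  unfold linkMul linkInd
  split_ifs <;> simp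

/-- For `SU(2)` and `z = -𝟙` the multiplier is Tomboulis's link sign. [cite: Tomboulis2007Confinement, §4 (text after (4.1))] -/
theorem linkMul_negOne (E : Finset (Edge d L)) (e : Edge d L) : linkMul negOne E e = linkSign E e := rfl

/-- For `SU(2)` and `z = -𝟙` the change of variables is `Tomboulis2007.flipLinks`.
[cite: Tomboulis2007Confinement, §4 (text after (4.1))] -/
theorem mulLinks_negOne (E : Finset (Edge d L)) (U : GaugeConfig d L SU2) : mulLinks negOne E U = flipLinks E U := rfl

/-- A central multiplier commutes with every link variable. [cite: Tomboulis2007Confinement, §4 (text after (4.1))] -/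
theorem linkMul_mul_comm {z : G} (hzc : ∀ g : G, z * g = g * z) (E : Finset (Edge d L)) (e : Edge d L) (U : G) :
    linkMul z E e * U = U * linkMul z E e := by
  unfold linkMul
  split_ifs
  · exact hzc U
  · rw [one_mul, mul_one]

/-- An involutive multiplier squares to `1`. [cite: Tomboulis2007Confinement, §4 (text after (4.1))] -/
theorem linkMul_mul_linkMul {z : G} (hz2 : z * z = 1) (E : Finset (Edge d L)) (e : Edge d L) :
    linkMul z E e * linkMul z E e = 1 := by
  unfold linkMul
  split_ifs
  · exact hz2
  · exact one_mul 1

/-- `(σ U)⁻¹ = σ U⁻¹` for a central involutive multiplier `σ`. [cite: Tomboulis2007Confinement, §4 (text after (4.1))] -/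
theorem linkMul_mul_inv {z : G} (hzc : ∀ g : G, z * g = g * z) (hz2 : z * z = 1) (E : Finset (Edge d L))
    (e : Edge d L) (U : G) : (linkMul z E e * U)⁻¹ = linkMul z E e * U⁻¹ := by
  have hinv : (linkMul z E e)⁻¹ = linkMul z E e :=
    inv_eq_of_mul_eq_one_right (linkMul_mul_linkMul hz2 E e)
  rw [mul_inv_rev, hinv, ← linkMul_mul_comm hzc]

/-- The change of variables by a central involution is an involution of the configuration space.
[cite: Tomboulis2007Confinement, §4 (text after (4.1))] -/
theorem mulLinks_mulLinks {z : G} (hz2 : z * z = 1) (E : Finset (Edge d L)) (U : GaugeConfig d L G) :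
    mulLinks z E (mulLinks z E U) = U := by
  funext e
  simp only [mulLinks, ← mul_assoc, linkMul_mul_linkMul hz2, one_mul]

/-- **The transformed holonomy**: under `U_b ↦ z U_b` (`b ∈ E`, `z` central with `z² = 1`) the plaquette holonomy
`U_p = U(x,i) U(x+eᵢ,j) U(x+eⱼ,i)⁻¹ U(x,j)⁻¹` is multiplied by `z^{k_p(E)}`, `k_p(E)` the number of boundary slots of `p`
in `E`. [cite: Tomboulis2007Confinement, §4 (text after (4.1))] -/
theorem plaquetteHolonomy_mulLinks {z : G} (hzc : ∀ g : G, z * g = g * z) (hz2 : z * z = 1) (E : Finset (Edge d L))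
    (U : GaugeConfig d L G) (x : Site d L) (i j : Fin d) :
    plaquetteHolonomy (mulLinks z E U) x i j = z ^ flipCount E x i j * plaquetteHolonomy U x i j := by
  simp only [plaquetteHolonomy, mulLinks, linkMul_mul_inv hzc hz2]
  set s₁ := linkMul z E (x, i)
  set s₂ := linkMul z E (x.shift i, j)
  set s₃ := linkMul z E (x.shift j, i)
  set s₄ := linkMul z E (x, j)
  have h₂ : ∀ V : G, s₂ * V = V * s₂ := linkMul_mul_comm hzc E _
  have h₃ : ∀ V : G, s₃ * V = V * s₃ := linkMul_mul_comm hzc E _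
  have h₄ : ∀ V : G, s₄ * V = V * s₄ := linkMul_mul_comm hzc E _
  have hpow : z ^ flipCount E x i j = s₁ * s₂ * s₃ * s₄ := by
    simp only [flipCount, pow_add, s₁, s₂, s₃, s₄, linkMul_eq_pow]
  rw [hpow]
  calc s₁ * U (x, i) * (s₂ * U (x.shift i, j)) * (s₃ * (U (x.shift j, i))⁻¹) * (s₄ * (U (x, j))⁻¹)
      = s₁ * (U (x, i) * s₂) * U (x.shift i, j) * s₃ * (U (x.shift j, i))⁻¹ * s₄ * (U (x, j))⁻¹ := by
        simp only [mul_assoc]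
    _ = s₁ * (s₂ * U (x, i)) * U (x.shift i, j) * s₃ * (U (x.shift j, i))⁻¹ * s₄ * (U (x, j))⁻¹ := by rw [h₂]
    _ = s₁ * s₂ * (U (x, i) * U (x.shift i, j) * s₃) * (U (x.shift j, i))⁻¹ * s₄ * (U (x, j))⁻¹ := by
        simp only [mul_assoc]
    _ = s₁ * s₂ * (s₃ * (U (x, i) * U (x.shift i, j))) * (U (x.shift j, i))⁻¹ * s₄ * (U (x, j))⁻¹ := by rw [h₃]
    _ = s₁ * s₂ * s₃ * (U (x, i) * U (x.shift i, j) * (U (x.shift j, i))⁻¹ * s₄) * (U (x, j))⁻¹ := by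
        simp only [mul_assoc]
    _ = s₁ * s₂ * s₃ * (s₄ * (U (x, i) * U (x.shift i, j) * (U (x.shift j, i))⁻¹)) * (U (x, j))⁻¹ := by rw [h₄]
    _ = s₁ * s₂ * s₃ * s₄ * (U (x, i) * U (x.shift i, j) * (U (x.shift j, i))⁻¹ * (U (x, j))⁻¹) := by
        simp only [mul_assoc]

/-- An involution to an even power is `1`. [cite: Tomboulis2007Confinement, §4 eq. (4.4)] -/
theorem pow_eq_one_of_even {z : G} (hz2 : z * z = 1) {k : ℕ} (hk : Even k) : z ^ k = 1 := by
  obtain ⟨m, rfl⟩ := hk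
  rw [← two_mul, pow_mul, pow_two, hz2, one_pow]

/-- An involution to an odd power is itself. [cite: Tomboulis2007Confinement, §4 eq. (4.4)] -/
theorem pow_eq_self_of_odd {z : G} (hz2 : z * z = 1) {k : ℕ} (hk : Odd k) : z ^ k = z := by
  obtain ⟨m, rfl⟩ := hk
  rw [pow_succ, pow_mul, pow_two, hz2, one_pow, one_mul]

section Haar

variable [TopologicalSpace G] [IsTopologicalGroup G] [CompactSpace G] [MeasurableSpace G] [BorelSpace G]

/-- **The change of variables `U_b ↦ z U_b` preserves the product Haar measure** `∏_b dU_b`: link by link it is a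
left translation, and `Measure.pi` is preserved factorwise. [cite: Tomboulis2007Confinement, §4 (text after (4.1))] -/
theorem measurePreserving_mulLinks (z : G) (E : Finset (Edge d L)) [NeZero L] :
    MeasurePreserving (mulLinks z E)
      (Measure.pi fun _ : Edge d L => haarProbability G) (Measure.pi fun _ : Edge d L => haarProbability G) :=
  measurePreserving_pi (f := fun (e : Edge d L) (x : G) => linkMul z E e * x)
    (fun _ : Edge d L => haarProbability G) (fun _ : Edge d L => haarProbability G)
    fun e => measurePreserving_mul_left (haarProbability G) (linkMul z E e)

end Haar

/-! ### Even and odd parts of a weight under `z` -/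

/-- The `z`-even part `w_+(U) = (w(U) + w(zU))/2` of a plaquette weight (for `SU(2)`: `centreEven`; for the character
action: `S¹`, arXiv:0707.2179 App. A §5). [cite: Tomboulis2007Confinement, App. A §5 eq. (A.17)] -/
def evenPart (z : G) (w : G → ℝ) (W : G) : ℝ := (w W + w (z * W)) / 2

/-- The `z`-odd part `w_-(U) = (w(U) - w(zU))/2` (for `SU(2)`: `centreOdd`; `S^{1/2}` of arXiv:0707.2179 App. A §5).
[cite: Tomboulis2007Confinement, App. A §5 eq. (A.17)] -/
def oddPart (z : G) (w : G → ℝ) (W : G) : ℝ := (w W - w (z * W)) / 2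

/-- For `SU(2)`, `z = -𝟙`: `evenPart = centreEven`. [cite: Tomboulis2007Confinement, App. A §5 eq. (A.17)] -/
theorem evenPart_negOne (w : SU2 → ℝ) : evenPart negOne w = centreEven w := rfl

/-- For `SU(2)`, `z = -𝟙`: `oddPart = centreOdd`. [cite: Tomboulis2007Confinement, App. A §5 eq. (A.17)] -/
theorem oddPart_negOne (w : SU2 → ℝ) : oddPart negOne w = centreOdd w := rfl

/-- `w = w_+ + w_-`. [cite: Tomboulis2007Confinement, App. A §5 eq. (A.17)] -/
theorem evenPart_add_oddPart (z : G) (w : G → ℝ) (W : G) : evenPart z w W + oddPart z w W = w W := by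
  unfold evenPart oddPart; ring

/-- `w(zU) = w_+(U) - w_-(U)`. [cite: Tomboulis2007Confinement, App. A §5 eq. (A.17)] -/
theorem evenPart_sub_oddPart (z : G) (w : G → ℝ) (W : G) : evenPart z w W - oddPart z w W = w (z * W) := by
  unfold evenPart oddPart; ring

/-- `w_+(zU) = w_+(U)` (`z² = 1`). [cite: Tomboulis2007Confinement, §4 eq. (4.4)] -/
theorem evenPart_mul {z : G} (hz2 : z * z = 1) (w : G → ℝ) (W : G) : evenPart z w (z * W) = evenPart z w W := by
  unfold evenPart
  rw [← mul_assoc, hz2, one_mul]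
  ring

/-- `w_-(zU) = -w_-(U)` (`z² = 1`). [cite: Tomboulis2007Confinement, §4 eq. (4.4)] -/
theorem oddPart_mul {z : G} (hz2 : z * z = 1) (w : G → ℝ) (W : G) : oddPart z w (z * W) = -oddPart z w W := by
  unfold oddPart
  rw [← mul_assoc, hz2, one_mul]
  ring

/-- `w_+(z^k U) = w_+(U)`. [cite: Tomboulis2007Confinement, §4 eq. (4.4)] -/
theorem evenPart_pow_mul {z : G} (hz2 : z * z = 1) (w : G → ℝ) (k : ℕ) (W : G) :
    evenPart z w (z ^ k * W) = evenPart z w W := by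
  induction k generalizing W with
  | zero => simp
  | succ k ih => rw [pow_succ, mul_assoc, ih, evenPart_mul hz2]

/-- `w_-(z^k U) = (-1)^k w_-(U)`. [cite: Tomboulis2007Confinement, §4 eq. (4.4)] -/
theorem oddPart_pow_mul {z : G} (hz2 : z * z = 1) (w : G → ℝ) (k : ℕ) (W : G) :
    oddPart z w (z ^ k * W) = (-1 : ℝ) ^ k * oddPart z w W := by
  induction k generalizing W with
  | zero => simp
  | succ k ih => rw [pow_succ, mul_assoc, ih, oddPart_mul hz2, pow_succ]; ring

/-! ### Activities and the twisted partition function of a weight -/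

/-- **The plaquette activity of the weight `w` with `z`-twist on `V`**: `w(z U_p) - 1` for `p ∈ V`, `w(U_p) - 1` otherwise
(arXiv:0707.2179 (6.7) with the replacement (4.4) `U_p → (-𝟙) U_p` on the twisted plaquettes; Ito–Seiler 2008 Remark 2.1 (3)
for `U(1)`). [cite: Tomboulis2007Confinement, §6.2 eq. (6.7) and §4 eq. (4.4)] [cite: ItoSeiler2008Further, §2 Remark 2.1 (3)] -/
def twistActivity (z : G) (w : G → ℝ) (V : Finset (Plaquette d L)) (U : GaugeConfig d L G) (p : Plaquette d L) : ℝ :=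
  (if p ∈ V then w (z * plaquetteHolonomy U p.1 p.2.1.1 p.2.1.2)
    else w (plaquetteHolonomy U p.1 p.2.1.1 p.2.1.2)) - 1

/-- For `SU(2)`, `z = -𝟙`: `twistActivity = weightActivity`. [cite: Tomboulis2007Confinement, §6.2 eq. (6.7)] -/
theorem twistActivity_negOne (w : SU2 → ℝ) (V : Finset (Plaquette d L)) :
    twistActivity negOne w V = weightActivity w V := rfl

/-- On the twist set the activity is `w(z U_p) - 1`. [cite: Tomboulis2007Confinement, §4 eq. (4.4)] -/
theorem twistActivity_of_mem (z : G) {w : G → ℝ} {V : Finset (Plaquette d L)} {p : Plaquette d L} (hp : p ∈ V)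
    (U : GaugeConfig d L G) :
    twistActivity z w V U p = w (z * plaquetteHolonomy U p.1 p.2.1.1 p.2.1.2) - 1 := by
  simp [twistActivity, hp]

/-- Off the twist set the activity is `w(U_p) - 1`. [cite: Tomboulis2007Confinement, §6.2 eq. (6.7)] -/
theorem twistActivity_of_not_mem (z : G) {w : G → ℝ} {V : Finset (Plaquette d L)} {p : Plaquette d L} (hp : p ∉ V)
    (U : GaugeConfig d L G) :
    twistActivity z w V U p = w (plaquetteHolonomy U p.1 p.2.1.1 p.2.1.2) - 1 := by
  simp [twistActivity, hp]

/-- `1 +` activity is the (twisted or untwisted) weight. [cite: Tomboulis2007Confinement, §4 eq. (4.5)] -/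
theorem one_add_twistActivity (z : G) (w : G → ℝ) (V : Finset (Plaquette d L)) (U : GaugeConfig d L G)
    (p : Plaquette d L) :
    1 + twistActivity z w V U p =
      (if p ∈ V then w (z * plaquetteHolonomy U p.1 p.2.1.1 p.2.1.2)
        else w (plaquetteHolonomy U p.1 p.2.1.1 p.2.1.2)) := by
  unfold twistActivity; ring

/-- The activity splits as `(w_+ - 1) ± w_-`: `+` off the twist set, `-` on it (arXiv:0707.2179 App. A §5:
`f = S¹ + S^{1/2}`, `f⁻ = S¹ - S^{1/2}`). [cite: Tomboulis2007Confinement, App. A §5 eq. (A.17)] -/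
theorem twistActivity_eq_evenPart_add_sign_mul_oddPart (z : G) (w : G → ℝ) (V : Finset (Plaquette d L))
    (U : GaugeConfig d L G) (p : Plaquette d L) :
    twistActivity z w V U p =
      (if p ∈ V then (-1 : ℝ) else 1) * oddPart z w (plaquetteHolonomy U p.1 p.2.1.1 p.2.1.2) +
        (evenPart z w (plaquetteHolonomy U p.1 p.2.1.1 p.2.1.2) - 1) := by
  by_cases hp : p ∈ V
  · rw [twistActivity_of_mem z hp, if_pos hp, ← evenPart_sub_oddPart z w (plaquetteHolonomy U p.1 p.2.1.1 p.2.1.2)]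
    ring
  · rw [twistActivity_of_not_mem z hp, if_neg hp, ← evenPart_add_oddPart z w (plaquetteHolonomy U p.1 p.2.1.1 p.2.1.2)]
    ring

section Measure

variable [TopologicalSpace G] [IsTopologicalGroup G] [CompactSpace G] [MeasurableSpace G] [BorelSpace G]
variable [NeZero L]

/-- **The polymer activity of the weight `w` with `z`-twist on `V`**: `z^{(V)}(X) = ∫ ∏_{p∈X} (w^{(V)}(U_p) - 1) ∏_b dU_b`
(complex; `0` unless `X` is a polymer) (arXiv:0707.2179 eq. (6.6)). [cite: Tomboulis2007Confinement, §6.2 eq. (6.6)] -/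
def twistPolymerActivity (z : G) (w : G → ℝ) (V X : Finset (Plaquette d L)) : ℂ :=
  by classical exact
  if IsRConnected linkRel X then
    (((∫ U, ∏ p ∈ X, twistActivity z w V U p ∂(Measure.pi fun _ : Edge d L => haarProbability G)) : ℝ) : ℂ)
  else 0

/-- The activity of a polymer is the Haar integral of the product of its plaquette activities.
[cite: Tomboulis2007Confinement, §6.2 eq. (6.6)] -/
theorem twistPolymerActivity_of_isRConnected (z : G) {w : G → ℝ} {V X : Finset (Plaquette d L)}
    (hX : IsRConnected linkRel X) :
    twistPolymerActivity z w V X =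
      (((∫ U, ∏ p ∈ X, twistActivity z w V U p ∂(Measure.pi fun _ : Edge d L => haarProbability G)) : ℝ) : ℂ) := by
  classical
  simp [twistPolymerActivity, hX]

/-- Non-polymers carry no activity. [cite: Tomboulis2007Confinement, §6.2 eq. (6.6)] -/
theorem twistPolymerActivity_of_not_isRConnected (z : G) {w : G → ℝ} {V X : Finset (Plaquette d L)}
    (hX : ¬ IsRConnected linkRel X) : twistPolymerActivity z w V X = 0 := by
  classical
  simp [twistPolymerActivity, hX]

/-- For `SU(2)`, `z = -𝟙`: `twistPolymerActivity = weightPolymerActivity`. [cite: Tomboulis2007Confinement, §6.2 eq. (6.6)] -/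
theorem twistPolymerActivity_negOne (w : SU2 → ℝ) (V X : Finset (Plaquette d L)) :
    twistPolymerActivity negOne w V X = weightPolymerActivity w V X := by
  by_cases hX : IsRConnected linkRel X
  · rw [twistPolymerActivity_of_isRConnected negOne hX, weightPolymerActivity_of_isRConnected hX]
    rfl
  · rw [twistPolymerActivity_of_not_isRConnected negOne hX, weightPolymerActivity_of_not_isRConnected hX]

variable (d L) in
/-- **The twisted partition function of the weight `w`** with `z`-twist on `V`: `∫ ∏_p w^{(V)}(U_p) ∏_b dU_b`
(arXiv:0707.2179 (4.5) for a general weight and group; for Wilson's weight and `V` the stack of a plane this is 't Hooft's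
twisted partition function `twistedPartitionFunction ρ β L z q` up to the constant `e^{-βN#plaquettes}`).
[cite: Tomboulis2007Confinement, §4 eq. (4.5)] -/
def twistZ (z : G) (w : G → ℝ) (V : Finset (Plaquette d L)) : ℝ :=
  ∫ U, ∏ p : Plaquette d L,
      (if p ∈ V then w (z * plaquetteHolonomy U p.1 p.2.1.1 p.2.1.2)
        else w (plaquetteHolonomy U p.1 p.2.1.1 p.2.1.2))
    ∂(Measure.pi fun _ : Edge d L => haarProbability G)

/-- For `SU(2)`, `z = -𝟙`: `twistZ = weightZ` (hence `torusZtw` for the character action, `weightZ_plaqFn`).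
[cite: Tomboulis2007Confinement, §4 eq. (4.5)] -/
theorem twistZ_negOne (w : SU2 → ℝ) (V : Finset (Plaquette d L)) : twistZ d L negOne w V = weightZ d L w V := rfl

/-- Without twisted plaquettes the twist element is immaterial. [cite: Tomboulis2007Confinement, §4 eq. (4.5)] -/
theorem twistZ_empty (z z' : G) (w : G → ℝ) : twistZ d L z w (∅ : Finset (Plaquette d L)) = twistZ d L z' w ∅ := by
  unfold twistZ
  simp

/-- Scaling the weight by a constant scales `twistZ` by its `#plaquettes`-th power (so the vortex ratio is
scale-invariant). [cite: Tomboulis2007Confinement, §6.1 eq. (6.1)] -/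
theorem twistZ_const_mul (z : G) (κ : ℝ) (w : G → ℝ) (V : Finset (Plaquette d L)) :
    twistZ d L z (fun W => κ * w W) V = κ ^ Fintype.card (Plaquette d L) * twistZ d L z w V := by
  unfold twistZ
  rw [← integral_const_mul]
  congr 1
  funext U
  rw [← Finset.card_univ, ← Finset.prod_const, ← Finset.prod_mul_distrib]
  refine Finset.prod_congr rfl fun p _ => ?_
  split_ifs <;> rfl

end Measure

end CentralTwist

end Literature.MathematicalPhysics.QuantumFieldTheory

end
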